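import Mathlib
import Summits.AtomisticToContinuum.BoseEinsteinCondensation.Theses.BECCellInformation
import Literature.MathematicalPhysics.QuantumManyBody.BoseGasFreeDirichletBEC
import Summits.AtomisticToContinuum.BoseEinsteinCondensation.Theorems.BECCellInformationTwoScaleReductionChainRule

/-!
# Route `BECCellInformation` — support item `TwoScaleReduction` (stmt-AtomisticToContinuum-13443)

Closes stmt-AtomisticToContinuum-13443: the exact signature of
`Summit.AtomisticToContinuum.BoseEinsteinCondensation.Theses.BECCellInformation.TwoScaleReduction`,

  `EnergyPerParticleBound → (coarse conditional entropy bound at some cell side l) → CondEntropyBound`.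

Proof (as filed by the planner, with a DEFECTIVE cube log-Sobolev inequality in place of the
sharp one — any constant in front of the kinetic energy does): for a non-negative
`δ`-near-minimiser `Ψ` of the Dirichlet energy in `Λ_L`, `L = (N/ρ)^{1/3}`, `N = n + 1`, and a
bath configuration `Y`, the slice `f = Ψ(·, Y)` is `C¹`, non-negative and vanishes off `Λ_L`, so
`fibre_two_scale` (`…ChainRule.lean`: exact KL chain rule over the tiling of `[0,L)³` by
`M³ = ⌈L/l⌉³` half-open cubes of side `s = L/M ≤ l`, plus the cube LSI of `…LSIBox.lean`) gives

  `m(Y) KL(p(·|Y) ‖ u_Λ) ≤ m(Y) KL(Q(·|Y) ‖ ū) + 3 m(Y) + s² ∫ |∇ₓΨ(x, Y)|² dx`.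

Integrating `dY`: the first term is the hypothesis (`≤ C'`, with `δ ≤ δ_coarse`), `∫ m dY = 1`
(`lintegral_config_succ`, normalisation), and by Bose symmetry
`∫∫ |∇ₓΨ|² = T(Ψ)/N` (`lintegral_kineticDensity_eq_mul`, `lintegral_partialGradSq_zero_eq` of
`BoseGasFreeDirichletBEC`) with `T ≤ energy ≤ E₀ + 1 ≤ K N + 1` (`EnergyPerParticleBound`,
`δ ≤ 1`). Constants: `ρ₀ = min`, `δ = min δ_coarse 1`, `C = max C' 0 + 3 + l² (max K 0 + 1)`;
the `atTop` filter is shifted to `N = n + 1` (`tendsto_add_atTop_nat`).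
-/

noncomputable section

namespace Summit.AtomisticToContinuum.BoseEinsteinCondensation.Theorems

open MeasureTheory Set
open scoped ENNReal NNReal Topology

namespace TwoScaleReduction

open Literature.MathematicalPhysics.QuantumManyBody.BoseGas InformationTheory Filter

/-! ### Small measure-theoretic helpers -/

/-- `ofReal (∫ f) ≤ ∫⁻ ofReal f` for a pointwise nonnegative real function (with Bochner's junk
value `0` when `f` is not integrable). [folklore] -/
theorem ofReal_integral_le_lintegral {α : Type*} [MeasurableSpace α] {μ : Measure α}
    {f : α → ℝ} (hf : ∀ x, 0 ≤ f x) :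
    ENNReal.ofReal (∫ x, f x ∂μ) ≤ ∫⁻ x, ENNReal.ofReal (f x) ∂μ := by
  by_cases hfi : Integrable f μ
  · rw [ofReal_integral_eq_lintegral_ofReal hfi (ae_of_all _ hf)]
  · rw [integral_undef hfi, ENNReal.ofReal_zero]
    exact bot_le

/-- The slice mass `Y ↦ ∫ |Ψ(z, Y)|² dz` (Bochner) of a continuous `Ψ` is measurable. [folklore] -/
theorem measurable_integral_norm_sq_vecCons {n : ℕ} {Ψ : Config (n + 1) → ℂ} (hΨ : Continuous Ψ) :
    Measurable fun Y : Config n => ∫ z, ‖Ψ (Matrix.vecCons z Y)‖ ^ 2 := by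
  have hF : Continuous fun p : Space × Config n => ‖Ψ (Matrix.vecCons p.1 p.2)‖ ^ 2 :=
    (hΨ.comp (continuous_fst.matrixVecCons continuous_snd)).norm.pow 2
  exact (hF.stronglyMeasurable.integral_prod_left' (μ := volume)).measurable

/-- `∫ dY ofReal(∫ |Ψ(z,Y)|² dz) ≤ ∫ |Ψ|² ` (`= 1` for a normalised state). [folklore] -/
theorem lintegral_ofReal_sliceMass_le {n : ℕ} {Ψ : Config (n + 1) → ℂ} (hΨ : Measurable Ψ) :
    ∫⁻ Y : Config n, ENNReal.ofReal (∫ z, ‖Ψ (Matrix.vecCons z Y)‖ ^ 2) ≤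
      ∫⁻ X, (‖Ψ X‖₊ : ℝ≥0∞) ^ 2 := by
  rw [lintegral_config_succ (hΨ.nnnorm.coe_nnreal_ennreal.pow_const 2)]
  refine lintegral_mono fun Y => (ofReal_integral_le_lintegral fun z => sq_nonneg _).trans_eq ?_
  refine lintegral_congr fun z => ?_
  rw [ENNReal.ofReal_pow (norm_nonneg _), ofReal_norm, enorm_eq_nnnorm]

/-! ### The theorem -/

/-- **`TwoScaleReduction` (route `BECCellInformation`, stmt-AtomisticToContinuum-13443).**
`EnergyPerParticleBound → (coarse conditional entropy bound at some scale l) → CondEntropyBound`: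
for every non-negative near-minimiser `Ψ` and every bath configuration `Y`, the exact KL chain
rule over the tiling of `[0,L)³` by `M³ = ⌈L/l⌉³` half-open cubes of side `s = L/M ≤ l` and the
defective cube log-Sobolev inequality give (`fibre_two_scale`)
`m(Y)·KL(p(·|Y) ‖ u_Λ) ≤ m(Y)·KL(Q(·|Y) ‖ ū) + 3 m(Y) + s² ∫ |∇ₓΨ(x,Y)|² dx`;
integrating `dY`, `∫ m = 1`, Bose symmetry `∫∫|∇ₓΨ|² = T(Ψ)/N` (`lintegral_kineticDensity_eq_mul`)
and `T ≤ energy ≤ E₀ + 1 ≤ K N + 1` give the bound with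
`C = max C' 0 + 3 + l² (max K 0 + 1)` and `δ = min δ_coarse 1`. -/
theorem twoScaleReduction_proof :
    Summit.AtomisticToContinuum.BoseEinsteinCondensation.Theses.BECCellInformation.TwoScaleReduction := by
  unfold Summit.AtomisticToContinuum.BoseEinsteinCondensation.Theses.BECCellInformation.TwoScaleReduction
    Summit.AtomisticToContinuum.BoseEinsteinCondensation.Theses.BECCellInformation.CondEntropyBound
  intro hE hC v hv
  obtain ⟨ρ₁, hρ₁, hE1⟩ := hE v hv
  obtain ⟨ρ₂, hρ₂, hC2⟩ := hC v hv
  refine ⟨min ρ₁ ρ₂, lt_min hρ₁ hρ₂, fun ρ hρ hρlt => ?_⟩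
  obtain ⟨K, hK⟩ := hE1 ρ hρ (hρlt.trans_le (min_le_left _ _))
  obtain ⟨l, hl, C', hC'⟩ := hC2 ρ hρ (hρlt.trans_le (min_le_right _ _))
  refine ⟨max C' 0 + 3 + l ^ 2 * (max K 0 + 1), ?_⟩
  have hK' : ∀ᶠ n : ℕ in atTop, groundStateEnergy v (n + 1) (sideLength ρ (n + 1)) ≤
      ENNReal.ofReal (K * ((n + 1 : ℕ) : ℝ)) := (tendsto_add_atTop_nat 1).eventually hK
  filter_upwards [hK', hC'] with n hKn hCn
  obtain ⟨δ, hδ, hΨ⟩ := hCn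
  -- the box, the number of cells per axis, the cell side
  set L := sideLength ρ (n + 1) with hLdef
  have hL : 0 < L := Real.rpow_pos_of_pos (div_pos (by exact_mod_cast Nat.succ_pos n) hρ) _
  set M := ⌈L / l⌉₊ with hMdef
  have hM : 1 ≤ M := Nat.one_le_iff_ne_zero.2 (Nat.ceil_pos.2 (div_pos hL hl)).ne'
  have hMpos : (0 : ℝ) < M := by exact_mod_cast hM
  have hsl : L / M ≤ l := by
    rw [div_le_iff₀ hMpos]
    have h := Nat.le_ceil (L / l)
    rw [div_le_iff₀ hl] at h
    linarith
  have hsl2 : (L / M) ^ 2 ≤ l ^ 2 := pow_le_pow_left₀ (div_nonneg hL.le hMpos.le) hsl 2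
  refine ⟨min δ 1, lt_min hδ one_pos, fun Ψ hΨE hΨreal => ?_⟩
  -- the coarse bound applies to `Ψ`
  have hΨδ : energy v Ψ ≤ groundStateEnergy v (n + 1) L + δ :=
    hΨE.trans (add_le_add le_rfl (min_le_left _ _))
  have hcoarse := hΨ Ψ hΨδ hΨreal
  -- the kinetic energy per particle of `Ψ`
  have hdiff : Differentiable ℝ Ψ.ψ := Ψ.contDiff.differentiable_one
  have hkin : ∫⁻ X, partialGradSq 0 Ψ.ψ X ≤ ENNReal.ofReal (max K 0) + 1 := by
    have hN0 : ((n + 1 : ℕ) : ℝ≥0∞) ≠ 0 := by exact_mod_cast Nat.succ_ne_zero n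
    have hNtop : ((n + 1 : ℕ) : ℝ≥0∞) ≠ ⊤ := ENNReal.natCast_ne_top _
    rw [← ENNReal.mul_le_mul_iff_right hN0 hNtop]
    have hT : ((n + 1 : ℕ) : ℝ≥0∞) * ∫⁻ X, partialGradSq 0 Ψ.ψ X = ∫⁻ X, kineticDensity Ψ.ψ X := by
      rw [lintegral_kineticDensity_eq_mul hdiff Ψ.symm]; push_cast; ring
    rw [hT]
    calc ∫⁻ X, kineticDensity Ψ.ψ X ≤ energy v Ψ := lintegral_mono fun X => le_self_add
      _ ≤ groundStateEnergy v (n + 1) L + min δ 1 := hΨE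
      _ ≤ ENNReal.ofReal (K * ((n + 1 : ℕ) : ℝ)) + 1 := add_le_add hKn (min_le_right _ _)
      _ ≤ ENNReal.ofReal (max K 0 * ((n + 1 : ℕ) : ℝ)) + ((n + 1 : ℕ) : ℝ≥0∞) * 1 := by
          gcongr
          · exact le_max_left _ _
          · rw [mul_one]; exact_mod_cast Nat.succ_pos n
      _ = ((n + 1 : ℕ) : ℝ≥0∞) * (ENNReal.ofReal (max K 0) + 1) := by
          rw [ENNReal.ofReal_mul (le_max_right _ _), ENNReal.ofReal_natCast]; ring
  -- fibrewise two-scale reduction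
  have hfib : ∀ Y : Config n,
      ∫⁻ x in box L, ENNReal.ofReal ((∫ z, ‖Ψ.ψ (Matrix.vecCons z Y)‖ ^ 2) / L ^ 3 *
          klFun (L ^ 3 * ‖Ψ.ψ (Matrix.vecCons x Y)‖ ^ 2 / ∫ z, ‖Ψ.ψ (Matrix.vecCons z Y)‖ ^ 2)) ≤
        ENNReal.ofReal (∑ q : Fin 3 → Fin M, (∫ z, ‖Ψ.ψ (Matrix.vecCons z Y)‖ ^ 2) / (M : ℝ) ^ 3 *
            klFun ((M : ℝ) ^ 3 * (∫ x in {y : Space | ∀ j, y j ∈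
              Ico (((q j : ℕ) : ℝ) * (L / M)) ((((q j : ℕ) : ℝ) + 1) * (L / M))},
              ‖Ψ.ψ (Matrix.vecCons x Y)‖ ^ 2) / ∫ z, ‖Ψ.ψ (Matrix.vecCons z Y)‖ ^ 2)) +
          ENNReal.ofReal (3 * ∫ z, ‖Ψ.ψ (Matrix.vecCons z Y)‖ ^ 2) +
          ENNReal.ofReal ((L / M) ^ 2) * ∫⁻ x, gradSqC (fun y => Ψ.ψ (Matrix.vecCons y Y)) x :=
    fun Y => fibre_two_scale hL hM (contDiff_vecCons_slice Ψ.contDiff Y) (fun x => hΨreal _)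
      fun x hx => Ψ.eq_zero _ fun hX => hx (by simpa using hX 0)
  -- measurability of the last two summands
  have hm2 : Measurable fun Y : Config n =>
      ENNReal.ofReal (3 * ∫ z, ‖Ψ.ψ (Matrix.vecCons z Y)‖ ^ 2) :=
    ((measurable_integral_norm_sq_vecCons Ψ.contDiff.continuous).const_mul 3).ennreal_ofReal
  have hm3 : Measurable fun Y : Config n =>
      ENNReal.ofReal ((L / M) ^ 2) * ∫⁻ x, gradSqC (fun y => Ψ.ψ (Matrix.vecCons y Y)) x :=
    (measurable_lintegral_gradSqC_vecCons hdiff).const_mul _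
  -- the three integrated bounds
  have hI2 : ∫⁻ Y : Config n, ENNReal.ofReal (3 * ∫ z, ‖Ψ.ψ (Matrix.vecCons z Y)‖ ^ 2) ≤ 3 := by
    have h3 : ∀ Y : Config n, ENNReal.ofReal (3 * ∫ z, ‖Ψ.ψ (Matrix.vecCons z Y)‖ ^ 2) =
        3 * ENNReal.ofReal (∫ z, ‖Ψ.ψ (Matrix.vecCons z Y)‖ ^ 2) := fun Y => by
      rw [ENNReal.ofReal_mul (by norm_num), ENNReal.ofReal_ofNat]
    simp_rw [h3]
    rw [lintegral_const_mul _ (measurable_integral_norm_sq_vecCons Ψ.contDiff.continuous).ennreal_ofReal]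
    calc (3 : ℝ≥0∞) * ∫⁻ Y : Config n, ENNReal.ofReal (∫ z, ‖Ψ.ψ (Matrix.vecCons z Y)‖ ^ 2)
        ≤ 3 * ∫⁻ X, (‖Ψ.ψ X‖₊ : ℝ≥0∞) ^ 2 := by
          gcongr; exact lintegral_ofReal_sliceMass_le Ψ.contDiff.continuous.measurable
      _ = 3 := by rw [Ψ.norm_eq, mul_one]
  have hI3 : ∫⁻ Y : Config n, ∫⁻ x, gradSqC (fun y => Ψ.ψ (Matrix.vecCons y Y)) x ≤
      ENNReal.ofReal (max K 0) + 1 := by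
    rw [← lintegral_partialGradSq_zero_eq hdiff]; exact hkin
  -- assemble
  calc ∫⁻ Y : Config n, ∫⁻ x in box L, ENNReal.ofReal ((∫ z, ‖Ψ.ψ (Matrix.vecCons z Y)‖ ^ 2) /
          L ^ 3 * klFun (L ^ 3 * ‖Ψ.ψ (Matrix.vecCons x Y)‖ ^ 2 /
            ∫ z, ‖Ψ.ψ (Matrix.vecCons z Y)‖ ^ 2))
      ≤ ∫⁻ Y : Config n, (ENNReal.ofReal (∑ q : Fin 3 → Fin M,
            (∫ z, ‖Ψ.ψ (Matrix.vecCons z Y)‖ ^ 2) / (M : ℝ) ^ 3 *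
            klFun ((M : ℝ) ^ 3 * (∫ x in {y : Space | ∀ j, y j ∈
              Ico (((q j : ℕ) : ℝ) * (L / M)) ((((q j : ℕ) : ℝ) + 1) * (L / M))},
              ‖Ψ.ψ (Matrix.vecCons x Y)‖ ^ 2) / ∫ z, ‖Ψ.ψ (Matrix.vecCons z Y)‖ ^ 2)) +
          ENNReal.ofReal (3 * ∫ z, ‖Ψ.ψ (Matrix.vecCons z Y)‖ ^ 2) +
          ENNReal.ofReal ((L / M) ^ 2) * ∫⁻ x, gradSqC (fun y => Ψ.ψ (Matrix.vecCons y Y)) x) :=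
        lintegral_mono hfib
    _ = (∫⁻ Y : Config n, ENNReal.ofReal (∑ q : Fin 3 → Fin M,
            (∫ z, ‖Ψ.ψ (Matrix.vecCons z Y)‖ ^ 2) / (M : ℝ) ^ 3 *
            klFun ((M : ℝ) ^ 3 * (∫ x in {y : Space | ∀ j, y j ∈
              Ico (((q j : ℕ) : ℝ) * (L / M)) ((((q j : ℕ) : ℝ) + 1) * (L / M))},
              ‖Ψ.ψ (Matrix.vecCons x Y)‖ ^ 2) / ∫ z, ‖Ψ.ψ (Matrix.vecCons z Y)‖ ^ 2))) +
          (∫⁻ Y : Config n, ENNReal.ofReal (3 * ∫ z, ‖Ψ.ψ (Matrix.vecCons z Y)‖ ^ 2)) +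
          ENNReal.ofReal ((L / M) ^ 2) *
            ∫⁻ Y : Config n, ∫⁻ x, gradSqC (fun y => Ψ.ψ (Matrix.vecCons y Y)) x := by
        rw [lintegral_add_right _ hm3, lintegral_add_right _ hm2,
          lintegral_const_mul _ (measurable_lintegral_gradSqC_vecCons hdiff)]
    _ ≤ ENNReal.ofReal C' + 3 + ENNReal.ofReal (l ^ 2) * (ENNReal.ofReal (max K 0) + 1) := by
        gcongr
    _ ≤ ENNReal.ofReal (max C' 0 + 3 + l ^ 2 * (max K 0 + 1)) := by
        rw [ENNReal.ofReal_add (by positivity) (by positivity),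
          ENNReal.ofReal_add (le_max_right _ _) (by norm_num), ENNReal.ofReal_mul (sq_nonneg _),
          ENNReal.ofReal_add (le_max_right _ _) zero_le_one, ENNReal.ofReal_one,
          ENNReal.ofReal_ofNat]
        gcongr
        exact le_max_left _ _

end TwoScaleReduction

end Summit.AtomisticToContinuum.BoseEinsteinCondensation.Theorems
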